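import Summits.NavierStokesRegularity.NavierStokesRegularity.Theorems.ExtremiserTransienceNearExtremalTransienceExtremiserLiouvilleConstantSpeedSlideJetKinematics
import HarnessLib

/-!
# Crux `ExtremiserTransience.NearExtremalTransience` (stmt-NavierStokesRegularity-21883), line `extremiser_liouville`,
# stub K1b — THE INDEFINITE HESSIAN TERM `|∇∇_hV₂|²` OF `−Ĉ₁` IS QUARTIC-GRADIENT PLUS `σ²|D²V|²` (R6b glue, record §15/§17/§18)

`--supports stmt-NavierStokesRegularity-21883` (helper).  Author: prover seat `ns-el-k1b` (g9).

After `…ConstantSpeedSlidePalinstrophyCancellation` the only indefinite second-order entry of `−Ĉ₁` is `−∫γ|∇∇_hV₂|²`,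
`|∇∇_hV₂|² = Σᵢ[(∂ᵢ∂₀V)₂² + (∂ᵢ∂₁V)₂²]`.  For the constant-speed jet (`‖v‖ ≡ M`, `c = (0,0,c₂)`, `|c₂| = M`, `V = v − c`) the
kinematics `c₂(∂ᵤ∂ₑV)₂ = −(⟪∂ᵤV,∂ₑV⟫ + ⟪V,∂ᵤ∂ₑV⟫)` (`…ConstantSpeedSlideJetKinematics`) give, pointwise,
```
  c₂²·Σᵢ[(∂ᵢ∂₀V)₂² + (∂ᵢ∂₁V)₂²] ≤ 2|DV|⁴_F + 2‖V‖²(|D∂₀V|²_F + |D∂₁V|²_F),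
```
whose right-hand side is exactly what `…ConstantSpeedSlideGradientL4` (`∫γ|DV|⁴_F`) and `…ConstantSpeedSlidePalinstrophyFrobenius`
(`Σₖ∫γ|D∂ₖV|²_F`) control on the layer where `‖V‖ ≤ σ`.
* `sq_le_two_mul_sq_add_two_mul_sq_of_abs_mul_le` : `|ct| ≤ p + q ⇒ c²t² ≤ 2p² + 2q²`;
* `sq_coord_two_mul_sum_sq_hessian_two_le` : the displayed bound.

WHAT THIS IS NOT: K1b is NOT proved; nothing here proves NS regularity. [folklore]
-/

noncomputable section

open Set Filter Topology MeasureTheory Metric Function InnerProductSpace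
open scoped ENNReal NNReal Topology InnerProductSpace RealInnerProductSpace ContDiff
open Literature.Analysis.FluidPDE Literature.Analysis

namespace Summit.NavierStokesRegularity.NavierStokesRegularity.Theorems

-- the problem directory repeats the summit name (`NavierStokesRegularity/NavierStokesRegularity`)
set_option linter.dupNamespace false

namespace ExtremiserLiouville

variable {v : EuclideanSpace ℝ (Fin 3) → EuclideanSpace ℝ (Fin 3)} {c : EuclideanSpace ℝ (Fin 3)} {M : ℝ}

/-- `|c·t| ≤ p + q ⇒ c²t² ≤ 2p² + 2q²`. [folklore] -/
theorem sq_le_two_mul_sq_add_two_mul_sq_of_abs_mul_le {a t p q : ℝ} (h : |a| * |t| ≤ p + q) :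
    a ^ 2 * t ^ 2 ≤ 2 * p ^ 2 + 2 * q ^ 2 := by
  have h0 : 0 ≤ |a| * |t| := mul_nonneg (abs_nonneg _) (abs_nonneg _)
  have h1 : (|a| * |t|) ^ 2 ≤ (p + q) ^ 2 := pow_le_pow_left₀ h0 h 2
  rw [mul_pow, sq_abs, sq_abs] at h1
  nlinarith [sq_nonneg (p - q)]

/-- **`c₂²|∇∇_hV₂|² ≤ 2|DV|⁴_F + 2‖V‖²(|D∂₀V|²_F + |D∂₁V|²_F)`** pointwise, for a constant-speed `C²` field `v` (`‖v‖ ≡ M`),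
`c = (0,0,c₂)`, `V = v − c` (`DV = Dv`); here `(∂ᵢ∂ₐV)₂ = D(DV(·)eₐ)(x)(bᵢ)₂` exactly as in
`slideCoeffDeriv_sub_inner_crossHessian_eq`, `|DV|²_F = frobeniusNormSq (DV)`, `|D∂ₐV|²_F = frobeniusNormSq (D(∂ₐV))`. [folklore] -/
theorem sq_coord_two_mul_sum_sq_hessian_two_le (hv : ContDiff ℝ 2 v) (hM : ∀ x, ‖v x‖ = M) (hc0 : c 0 = 0) (hc1 : c 1 = 0)
    (x : EuclideanSpace ℝ (Fin 3)) :
    c 2 ^ 2 * ∑ i : Fin 3, (fderiv ℝ (fun y => fderiv ℝ v y (EuclideanSpace.single (0 : Fin 3) (1 : ℝ))) x (EuclideanSpace.basisFun (Fin 3) ℝ i) 2 ^ 2 + fderiv ℝ (fun y => fderiv ℝ v y (EuclideanSpace.single (1 : Fin 3) (1 : ℝ))) x (EuclideanSpace.basisFun (Fin 3) ℝ i) 2 ^ 2) ≤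
      2 * frobeniusNormSq (fderiv ℝ v x) ^ 2 +
        2 * ‖v x - c‖ ^ 2 * (frobeniusNormSq (fderiv ℝ (fun y => fderiv ℝ v y (EuclideanSpace.single (0 : Fin 3) (1 : ℝ))) x) +
          frobeniusNormSq (fderiv ℝ (fun y => fderiv ℝ v y (EuclideanSpace.single (1 : Fin 3) (1 : ℝ))) x)) := by
  have hb0 : EuclideanSpace.basisFun (Fin 3) ℝ 0 = EuclideanSpace.single (0 : Fin 3) (1 : ℝ) := by simp [EuclideanSpace.basisFun_apply]
  have hb1 : EuclideanSpace.basisFun (Fin 3) ℝ 1 = EuclideanSpace.single (1 : Fin 3) (1 : ℝ) := by simp [EuclideanSpace.basisFun_apply]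
  -- per-entry bound from the jet kinematics
  have h : ∀ (i : Fin 3) (e : EuclideanSpace ℝ (Fin 3)), c 2 ^ 2 * fderiv ℝ (fun y => fderiv ℝ v y e) x (EuclideanSpace.basisFun (Fin 3) ℝ i) 2 ^ 2 ≤
      2 * (‖fderiv ℝ v x (EuclideanSpace.basisFun (Fin 3) ℝ i)‖ * ‖fderiv ℝ v x e‖) ^ 2 +
        2 * (‖v x - c‖ * ‖fderiv ℝ (fun y => fderiv ℝ v y e) x (EuclideanSpace.basisFun (Fin 3) ℝ i)‖) ^ 2 := fun i e =>
    sq_le_two_mul_sq_add_two_mul_sq_of_abs_mul_le (abs_coord_two_mul_fderiv_fderiv_apply_two_le hv hM hc0 hc1 x _ e)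
  -- Frobenius norms as sums over the basis
  have hF : frobeniusNormSq (fderiv ℝ v x) = ∑ i : Fin 3, ‖fderiv ℝ v x (EuclideanSpace.basisFun (Fin 3) ℝ i)‖ ^ 2 := frobeniusNormSq_eq_sum _ _
  have hF0 : frobeniusNormSq (fderiv ℝ (fun y => fderiv ℝ v y (EuclideanSpace.single (0 : Fin 3) (1 : ℝ))) x) =
      ∑ i : Fin 3, ‖fderiv ℝ (fun y => fderiv ℝ v y (EuclideanSpace.single (0 : Fin 3) (1 : ℝ))) x (EuclideanSpace.basisFun (Fin 3) ℝ i)‖ ^ 2 := frobeniusNormSq_eq_sum _ _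
  have hF1 : frobeniusNormSq (fderiv ℝ (fun y => fderiv ℝ v y (EuclideanSpace.single (1 : Fin 3) (1 : ℝ))) x) =
      ∑ i : Fin 3, ‖fderiv ℝ (fun y => fderiv ℝ v y (EuclideanSpace.single (1 : Fin 3) (1 : ℝ))) x (EuclideanSpace.basisFun (Fin 3) ℝ i)‖ ^ 2 := frobeniusNormSq_eq_sum _ _
  -- the two horizontal first derivatives are among the three
  have hsub : ‖fderiv ℝ v x (EuclideanSpace.single (0 : Fin 3) (1 : ℝ))‖ ^ 2 + ‖fderiv ℝ v x (EuclideanSpace.single (1 : Fin 3) (1 : ℝ))‖ ^ 2 ≤ ∑ i : Fin 3, ‖fderiv ℝ v x (EuclideanSpace.basisFun (Fin 3) ℝ i)‖ ^ 2 := by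
    rw [Fin.sum_univ_three, hb0, hb1]
    nlinarith [sq_nonneg ‖fderiv ℝ v x (EuclideanSpace.basisFun (Fin 3) ℝ 2)‖]
  have hS0 : 0 ≤ ∑ i : Fin 3, ‖fderiv ℝ v x (EuclideanSpace.basisFun (Fin 3) ℝ i)‖ ^ 2 := Finset.sum_nonneg fun i _ => sq_nonneg _
  -- sum the per-entry bounds
  calc c 2 ^ 2 * ∑ i : Fin 3, (fderiv ℝ (fun y => fderiv ℝ v y (EuclideanSpace.single (0 : Fin 3) (1 : ℝ))) x (EuclideanSpace.basisFun (Fin 3) ℝ i) 2 ^ 2 + fderiv ℝ (fun y => fderiv ℝ v y (EuclideanSpace.single (1 : Fin 3) (1 : ℝ))) x (EuclideanSpace.basisFun (Fin 3) ℝ i) 2 ^ 2)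
      = ∑ i : Fin 3, (c 2 ^ 2 * fderiv ℝ (fun y => fderiv ℝ v y (EuclideanSpace.single (0 : Fin 3) (1 : ℝ))) x (EuclideanSpace.basisFun (Fin 3) ℝ i) 2 ^ 2 + c 2 ^ 2 * fderiv ℝ (fun y => fderiv ℝ v y (EuclideanSpace.single (1 : Fin 3) (1 : ℝ))) x (EuclideanSpace.basisFun (Fin 3) ℝ i) 2 ^ 2) := by
        rw [Finset.mul_sum]; exact Finset.sum_congr rfl fun i _ => by ring
    _ ≤ ∑ i : Fin 3, ((2 * (‖fderiv ℝ v x (EuclideanSpace.basisFun (Fin 3) ℝ i)‖ * ‖fderiv ℝ v x (EuclideanSpace.single (0 : Fin 3) (1 : ℝ))‖) ^ 2 +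
          2 * (‖v x - c‖ * ‖fderiv ℝ (fun y => fderiv ℝ v y (EuclideanSpace.single (0 : Fin 3) (1 : ℝ))) x (EuclideanSpace.basisFun (Fin 3) ℝ i)‖) ^ 2) +
          (2 * (‖fderiv ℝ v x (EuclideanSpace.basisFun (Fin 3) ℝ i)‖ * ‖fderiv ℝ v x (EuclideanSpace.single (1 : Fin 3) (1 : ℝ))‖) ^ 2 +
          2 * (‖v x - c‖ * ‖fderiv ℝ (fun y => fderiv ℝ v y (EuclideanSpace.single (1 : Fin 3) (1 : ℝ))) x (EuclideanSpace.basisFun (Fin 3) ℝ i)‖) ^ 2)) :=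
        Finset.sum_le_sum fun i _ => add_le_add (h i _) (h i _)
    _ = ∑ i : Fin 3, (2 * (‖fderiv ℝ v x (EuclideanSpace.single (0 : Fin 3) (1 : ℝ))‖ ^ 2 + ‖fderiv ℝ v x (EuclideanSpace.single (1 : Fin 3) (1 : ℝ))‖ ^ 2) * ‖fderiv ℝ v x (EuclideanSpace.basisFun (Fin 3) ℝ i)‖ ^ 2 +
          2 * ‖v x - c‖ ^ 2 * (‖fderiv ℝ (fun y => fderiv ℝ v y (EuclideanSpace.single (0 : Fin 3) (1 : ℝ))) x (EuclideanSpace.basisFun (Fin 3) ℝ i)‖ ^ 2 + ‖fderiv ℝ (fun y => fderiv ℝ v y (EuclideanSpace.single (1 : Fin 3) (1 : ℝ))) x (EuclideanSpace.basisFun (Fin 3) ℝ i)‖ ^ 2)) :=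
        Finset.sum_congr rfl fun i _ => by ring
    _ = 2 * (‖fderiv ℝ v x (EuclideanSpace.single (0 : Fin 3) (1 : ℝ))‖ ^ 2 + ‖fderiv ℝ v x (EuclideanSpace.single (1 : Fin 3) (1 : ℝ))‖ ^ 2) * (∑ i : Fin 3, ‖fderiv ℝ v x (EuclideanSpace.basisFun (Fin 3) ℝ i)‖ ^ 2) +
          2 * ‖v x - c‖ ^ 2 * ((∑ i : Fin 3, ‖fderiv ℝ (fun y => fderiv ℝ v y (EuclideanSpace.single (0 : Fin 3) (1 : ℝ))) x (EuclideanSpace.basisFun (Fin 3) ℝ i)‖ ^ 2) + ∑ i : Fin 3, ‖fderiv ℝ (fun y => fderiv ℝ v y (EuclideanSpace.single (1 : Fin 3) (1 : ℝ))) x (EuclideanSpace.basisFun (Fin 3) ℝ i)‖ ^ 2) := by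
        rw [Finset.sum_add_distrib, ← Finset.mul_sum, ← Finset.mul_sum, Finset.sum_add_distrib]
    _ ≤ 2 * (∑ i : Fin 3, ‖fderiv ℝ v x (EuclideanSpace.basisFun (Fin 3) ℝ i)‖ ^ 2) * (∑ i : Fin 3, ‖fderiv ℝ v x (EuclideanSpace.basisFun (Fin 3) ℝ i)‖ ^ 2) +
          2 * ‖v x - c‖ ^ 2 * ((∑ i : Fin 3, ‖fderiv ℝ (fun y => fderiv ℝ v y (EuclideanSpace.single (0 : Fin 3) (1 : ℝ))) x (EuclideanSpace.basisFun (Fin 3) ℝ i)‖ ^ 2) + ∑ i : Fin 3, ‖fderiv ℝ (fun y => fderiv ℝ v y (EuclideanSpace.single (1 : Fin 3) (1 : ℝ))) x (EuclideanSpace.basisFun (Fin 3) ℝ i)‖ ^ 2) := by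
        have := mul_le_mul_of_nonneg_right hsub hS0
        nlinarith [this]
    _ = 2 * frobeniusNormSq (fderiv ℝ v x) ^ 2 +
        2 * ‖v x - c‖ ^ 2 * (frobeniusNormSq (fderiv ℝ (fun y => fderiv ℝ v y (EuclideanSpace.single (0 : Fin 3) (1 : ℝ))) x) +
          frobeniusNormSq (fderiv ℝ (fun y => fderiv ℝ v y (EuclideanSpace.single (1 : Fin 3) (1 : ℝ))) x)) := by
        rw [hF, hF0, hF1]; ring

end ExtremiserLiouville

end Summit.NavierStokesRegularity.NavierStokesRegularity.Theorems

end
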